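import Summits.FinalStateConjecture.FinalStateConjecture.Theses.KerrnessPropagates
import Summits.FinalStateConjecture.FinalStateConjecture.Theorems.EIHFluxBalanceInertialRecessionStubSlavingCOERCompactBoosts

/-!
# Route `KerrnessPropagates`, crux `KerrBasinCapture` (stmt-FinalStateConjecture-17646), line `registered`
# (skeleton `Cruxes/KerrBasinCapture/Lines/birth.lean`, lead rev 3) — stub `stub_marginCompactness`

**Compactness of the margin family (T1).** A *margin family* of multi-Kerr configurations is
cut out by the data `(N₀, m₀, χ, μ, v₀, L₀)`: at most `N₀` holes, masses `M i ∈ [m₀, m₀⁻¹]`,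
spins `|a i| ≤ χ M i`, inner radii `r₀ i ∈ [r₋(M i, a i) + μ, r₊(M i, a i) − μ]`, boosts `Λ i`
of pointwise operator bound `L₀`, and pairwise coordinate velocities
`(Λ i e₀)⁰⁻¹ (Λ i e₀)~` at mutual distance `≥ v₀`.  The stub `stub_marginCompactness` says that
a sequence of such configurations (a sequence in the `Σ`-type over the hole count) has a
subsequence with constant hole count `N ≤ N₀` along which masses, spins and inner radii
converge, the boosts converge in operator norm *together with their inverses*, and the limit
configuration again lies in the margin family.

Proof (folklore; Bolzano–Weierstrass):
* pigeonhole on the hole count (`Finite.exists_infinite_fiber` +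
  `Filter.extraction_of_frequently_atTop`), then the fibre of the `Σ`-type over `N` is
  straightened without casts (`sigma_fiber_eq`);
* all coordinates are bounded (`abs_coords_le`: `r₊ ≤ M + |M|`, `r₋ ≥ M − |M|`), and the boosts
  range in the compact set of `η`-isometric operators of bounded Lorentz factor
  (`isCompact_lorentzBounded` of `…Theorems.SublinearIsFree.Slaving`), so
  `IsCompact.tendsto_subseq` applies in the finite-dimensional product
  `(Fin N → ℝ)³ × (Fin N → (E4 →L E4))`;
* the limit operator is `η`-isometric, hence an element of `lorentzGroup`
  (`exists_lorentz_coe_eq`); inverses converge because `Ring.inverse` is continuous at units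
  (`NormedRing.inverse_continuousAt`) and `Ring.inverse ↑Λ = ↑Λ⁻¹`;
* the margins are closed conditions (`le_of_tendsto`-type lemmas, continuity of `√`, of
  evaluation, of `E4.spatial`, and of `x ↦ x⁻¹` away from `0`, the Lorentz factor being `≥ 1`).

No positivity of `m₀, μ, v₀, L₀` is used. [folklore]
-/

open scoped BigOperators Topology Manifold Classical Matrix InnerProductSpace ContinuousMap
open Filter Set Function TopologicalSpace
open Literature.Geometry.Lorentzian

-- D-0017: single-problem summit, `Summit.<S>.<S>.…` by design.
set_option linter.dupNamespace false

namespace Summit.FinalStateConjecture.FinalStateConjecture.Theorems.KerrnessPropagates.KerrBasinCapture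

open Summit.FinalStateConjecture.FinalStateConjecture.Theorems.SublinearIsFree.Slaving

/-- **Pigeonhole on the hole count.** A sequence of naturals bounded by `N₀` takes some value
`N ≤ N₀` along a strictly increasing subsequence (a finite-codomain map on `ℕ` has an infinite
fibre). [folklore] -/
private theorem exists_const_subseq (f : ℕ → ℕ) (N₀ : ℕ) (hf : ∀ n, f n ≤ N₀) :
    ∃ N, N ≤ N₀ ∧ ∃ φ : ℕ → ℕ, StrictMono φ ∧ ∀ n, f (φ n) = N := by
  obtain ⟨y, hy⟩ :=
    Finite.exists_infinite_fiber (fun n ↦ (⟨f n, Nat.lt_succ_of_le (hf n)⟩ : Fin (N₀ + 1)))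
  have hinf : Set.Infinite {n | (⟨f n, Nat.lt_succ_of_le (hf n)⟩ : Fin (N₀ + 1)) = y} :=
    Set.infinite_coe_iff.1 hy
  obtain ⟨φ, hφ, hφy⟩ :=
    extraction_of_frequently_atTop (Nat.frequently_atTop_iff_infinite.2 hinf)
  exact ⟨y.1, Nat.le_of_lt_succ y.2, φ, hφ, fun n ↦ congrArg Fin.val (hφy n)⟩

/-- **Straightening a fibre of a `Σ`-type.** A point of `Σ n, β n` whose first component is `N`
is `⟨N, q⟩` for some `q : β N` (no casts: destruct and substitute). [folklore] -/
private theorem sigma_fiber_eq {β : ℕ → Type*} {N : ℕ} :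
    ∀ p : (Σ n, β n), p.1 = N → ∃ q : β N, p = ⟨N, q⟩ := by
  rintro ⟨n, q⟩ rfl
  exact ⟨q, rfl⟩

/-- **The margin box is bounded.** If `m₀ ≤ M ≤ m₀⁻¹`, `|a| ≤ χ M` and
`r₋(M,a) + μ ≤ r ≤ r₊(M,a) − μ`, then `|M|, |a|, |r| ≤ 2B + |χ| B + |μ|` with `B = |m₀| + |m₀⁻¹|`
(`r₊ = M + √(M² − a²) ≤ M + |M|`, `r₋ ≥ M − |M|`). [folklore] -/
private theorem abs_coords_le {m₀ χ μ M a r : ℝ} (h1 : m₀ ≤ M) (h2 : M ≤ m₀⁻¹)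
    (h3 : |a| ≤ χ * M) (h4 : Kerr.rMinus M a + μ ≤ r) (h5 : r + μ ≤ Kerr.rPlus M a) :
    |M| ≤ 2 * (|m₀| + |m₀⁻¹|) + |χ| * (|m₀| + |m₀⁻¹|) + |μ| ∧
      |a| ≤ 2 * (|m₀| + |m₀⁻¹|) + |χ| * (|m₀| + |m₀⁻¹|) + |μ| ∧
      |r| ≤ 2 * (|m₀| + |m₀⁻¹|) + |χ| * (|m₀| + |m₀⁻¹|) + |μ| := by
  unfold Kerr.rMinus at h4
  unfold Kerr.rPlus at h5
  have hM : |M| ≤ |m₀| + |m₀⁻¹| := by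
    rw [abs_le]
    constructor
    · linarith [neg_abs_le m₀, abs_nonneg m₀⁻¹]
    · linarith [le_abs_self m₀⁻¹, abs_nonneg m₀]
  have hs : √(M ^ 2 - a ^ 2) ≤ |M| := by
    rw [← Real.sqrt_sq_eq_abs]
    exact Real.sqrt_le_sqrt (by nlinarith [sq_nonneg a])
  have ha : |a| ≤ |χ| * (|m₀| + |m₀⁻¹|) :=
    calc |a| ≤ χ * M := h3
      _ ≤ |χ * M| := le_abs_self _
      _ = |χ| * |M| := abs_mul χ M
      _ ≤ |χ| * (|m₀| + |m₀⁻¹|) := mul_le_mul_of_nonneg_left hM (abs_nonneg χ)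
  have hB : 0 ≤ |m₀| + |m₀⁻¹| := by positivity
  have hχB : 0 ≤ |χ| * (|m₀| + |m₀⁻¹|) := mul_nonneg (abs_nonneg χ) hB
  have hμ : 0 ≤ |μ| := abs_nonneg μ
  have hMl : -|M| ≤ M := neg_abs_le M
  have hMu : M ≤ |M| := le_abs_self M
  have hμl : -|μ| ≤ μ := neg_abs_le μ
  have hμu : μ ≤ |μ| := le_abs_self μ
  refine ⟨by linarith, by linarith, abs_le.2 ⟨by linarith, by linarith⟩⟩

/-- **Lorentz factor bound from the pointwise operator bound**: `|(Λ e₀)⁰| ≤ ‖Λ e₀‖ ≤ L₀ ‖e₀‖`.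
[folklore] -/
private theorem abs_apply_zero_le {L₀ : ℝ} (Λ : lorentzGroup)
    (h : ∀ v : E4, ‖(Λ : E4 ≃L[ℝ] E4) v‖ ≤ L₀ * ‖v‖) :
    |((Λ : E4 ≃L[ℝ] E4) : E4 →L[ℝ] E4) (E4.basisVector 0) 0| ≤
      L₀ * ‖(E4.basisVector 0 : E4)‖ := by
  rw [ContinuousLinearEquiv.coe_coe, ← Real.norm_eq_abs]
  exact (PiLp.norm_apply_le _ 0).trans (h _)

/-- **An `η`-isometric operator is a Lorentz transformation**: it is injective
(`injective_of_minkowski_isometry`), hence a linear automorphism of the finite-dimensional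
`E4`, and its coercion back to an operator is the operator we started from. [folklore] -/
private theorem exists_lorentz_coe_eq {L : E4 →L[ℝ] E4}
    (hL : ∀ v w, Minkowski.bilin (L v) (L w) = Minkowski.bilin v w) :
    ∃ Λ : lorentzGroup, ((Λ : E4 ≃L[ℝ] E4) : E4 →L[ℝ] E4) = L :=
  ⟨⟨LinearEquiv.toContinuousLinearEquiv
      (LinearEquiv.ofInjectiveEndo (L : E4 →ₗ[ℝ] E4) (injective_of_minkowski_isometry hL)),
    fun v w ↦ hL v w⟩, by ext v; rfl⟩

/-- **Bolzano–Weierstrass for `N` holes.** Bounded mass/spin/radius coordinates and boosts of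
pointwise operator bound `L₀` have a common convergent subsequence: the boosts range in the
compact set of `η`-isometric operators with Lorentz factor `≤ L₀ ‖e₀‖`
(`isCompact_lorentzBounded`), the coordinates in a compact box, and the limit operator is again
a Lorentz transformation (`exists_lorentz_coe_eq`). [folklore] -/
private theorem exists_tendsto_subseq {N : ℕ} (R L₀ : ℝ) (M a r : ℕ → Fin N → ℝ)
    (mo : ℕ → Fin N → ↥lorentzGroup × E4)
    (hb : ∀ n i, |M n i| ≤ R ∧ |a n i| ≤ R ∧ |r n i| ≤ R)
    (hmo : ∀ n i (v : E4), ‖((mo n i).1 : E4 ≃L[ℝ] E4) v‖ ≤ L₀ * ‖v‖) :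
    ∃ (φ : ℕ → ℕ) (Mₗ aₗ rₗ : Fin N → ℝ) (Λₗ : Fin N → ↥lorentzGroup), StrictMono φ ∧
      (∀ i, Tendsto (fun n ↦ M (φ n) i) atTop (𝓝 (Mₗ i))) ∧
      (∀ i, Tendsto (fun n ↦ a (φ n) i) atTop (𝓝 (aₗ i))) ∧
      (∀ i, Tendsto (fun n ↦ r (φ n) i) atTop (𝓝 (rₗ i))) ∧
      (∀ i, Tendsto (fun n ↦ (((mo (φ n) i).1 : E4 ≃L[ℝ] E4) : E4 →L[ℝ] E4)) atTop
        (𝓝 (((Λₗ i : E4 ≃L[ℝ] E4) : E4 →L[ℝ] E4)))) := by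
  have hI : IsCompact (Set.pi Set.univ fun _ : Fin N ↦ Set.Icc (-R) R) :=
    isCompact_univ_pi fun _ ↦ isCompact_Icc
  have hK := hI.prod (hI.prod (hI.prod (isCompact_univ_pi fun _ : Fin N ↦
    isCompact_lorentzBounded (L₀ * ‖(E4.basisVector 0 : E4)‖))))
  obtain ⟨p, hp, φ, hφ, hlim⟩ := hK.tendsto_subseq
    (x := fun n ↦ (M n, a n, r n, fun i ↦ (((mo n i).1 : E4 ≃L[ℝ] E4) : E4 →L[ℝ] E4))) (by
      intro n
      refine Set.mem_prod.2 ⟨Set.mem_univ_pi.2 fun i ↦ Set.mem_Icc.2 (abs_le.1 (hb n i).1),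
        Set.mem_prod.2 ⟨Set.mem_univ_pi.2 fun i ↦ Set.mem_Icc.2 (abs_le.1 (hb n i).2.1),
        Set.mem_prod.2 ⟨Set.mem_univ_pi.2 fun i ↦ Set.mem_Icc.2 (abs_le.1 (hb n i).2.2),
        Set.mem_univ_pi.2 fun i ↦ ⟨fun v w ↦ (mo n i).1.2 v w,
          abs_apply_zero_le (mo n i).1 (hmo n i)⟩⟩⟩⟩)
  have hP : ∀ i, ∀ v w, Minkowski.bilin (p.2.2.2 i v) (p.2.2.2 i w) = Minkowski.bilin v w :=
    fun i ↦ (Set.mem_univ_pi.1 hp.2.2.2 i).1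
  choose Λₗ hΛₗ using fun i ↦ exists_lorentz_coe_eq (hP i)
  refine ⟨φ, p.1, p.2.1, p.2.2.1, Λₗ, hφ, fun i ↦ tendsto_pi_nhds.1 hlim.fst_nhds i,
    fun i ↦ tendsto_pi_nhds.1 hlim.snd_nhds.fst_nhds i,
    fun i ↦ tendsto_pi_nhds.1 hlim.snd_nhds.snd_nhds.fst_nhds i, fun i ↦ ?_⟩
  rw [hΛₗ i]
  exact tendsto_pi_nhds.1 hlim.snd_nhds.snd_nhds.snd_nhds i

/-- **Inverses of convergent boosts converge**: `Ring.inverse` is continuous at units of the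
operator algebra (`NormedRing.inverse_continuousAt`) and `Ring.inverse ↑Λ = ↑Λ⁻¹` for a
Lorentz transformation `Λ`. [folklore] -/
private theorem tendsto_lorentz_symm {Λ : ℕ → lorentzGroup} {Λₗ : lorentzGroup}
    (h : Tendsto (fun n ↦ ((Λ n : E4 ≃L[ℝ] E4) : E4 →L[ℝ] E4)) atTop
      (𝓝 ((Λₗ : E4 ≃L[ℝ] E4) : E4 →L[ℝ] E4))) :
    Tendsto (fun n ↦ (((Λ n : E4 ≃L[ℝ] E4).symm : E4 ≃L[ℝ] E4) : E4 →L[ℝ] E4)) atTop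
      (𝓝 (((Λₗ : E4 ≃L[ℝ] E4).symm : E4 ≃L[ℝ] E4) : E4 →L[ℝ] E4)) := by
  have key : ∀ Λ' : lorentzGroup, Ring.inverse ((Λ' : E4 ≃L[ℝ] E4) : E4 →L[ℝ] E4) =
      (((Λ' : E4 ≃L[ℝ] E4).symm : E4 ≃L[ℝ] E4) : E4 →L[ℝ] E4) :=
    fun Λ' ↦ Ring.inverse_unit (ContinuousLinearEquiv.toUnit (Λ' : E4 ≃L[ℝ] E4))
  have hfun : (fun n ↦ (((Λ n : E4 ≃L[ℝ] E4).symm : E4 ≃L[ℝ] E4) : E4 →L[ℝ] E4)) =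
      Ring.inverse ∘ fun n ↦ ((Λ n : E4 ≃L[ℝ] E4) : E4 →L[ℝ] E4) :=
    funext fun n ↦ (key (Λ n)).symm
  rw [hfun, ← key Λₗ]
  exact (NormedRing.inverse_continuousAt
    (ContinuousLinearEquiv.toUnit (Λₗ : E4 ≃L[ℝ] E4))).tendsto.comp h

/-- **The pointwise operator bound is closed**: if `Λₙ → Λ` in operator norm and
`‖Λₙ v‖ ≤ L₀ ‖v‖` for all `n`, then `‖Λ v‖ ≤ L₀ ‖v‖` (evaluation at `v` is continuous).
[folklore] -/
private theorem norm_apply_le_of_tendsto {L₀ : ℝ} {Λ : ℕ → lorentzGroup} {Λₗ : lorentzGroup}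
    (hΛ : Tendsto (fun n ↦ ((Λ n : E4 ≃L[ℝ] E4) : E4 →L[ℝ] E4)) atTop
      (𝓝 ((Λₗ : E4 ≃L[ℝ] E4) : E4 →L[ℝ] E4)))
    (h : ∀ n (v : E4), ‖(Λ n : E4 ≃L[ℝ] E4) v‖ ≤ L₀ * ‖v‖) (v : E4) :
    ‖(Λₗ : E4 ≃L[ℝ] E4) v‖ ≤ L₀ * ‖v‖ := by
  have hv : Continuous fun L : E4 →L[ℝ] E4 ↦ L v := continuous_id.clm_apply continuous_const
  have h1 : Tendsto (fun n ↦ ((Λ n : E4 ≃L[ℝ] E4) : E4 →L[ℝ] E4) v) atTop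
      (𝓝 (((Λₗ : E4 ≃L[ℝ] E4) : E4 →L[ℝ] E4) v)) := (hv.tendsto _).comp hΛ
  simp only [ContinuousLinearEquiv.coe_coe] at h1
  exact le_of_tendsto h1.norm (Eventually.of_forall fun n ↦ h n v)

/-- **Coordinate velocities of convergent boosts converge**: `Λ ↦ (Λ e₀)⁰⁻¹ (Λ e₀)~` is
continuous at Lorentz transformations, since the Lorentz factor `(Λ e₀)⁰` has absolute value
`≥ 1` (`one_le_abs_lorentz_apply_zero`), hence is nonzero. [folklore] -/
private theorem tendsto_velocity {Λ : ℕ → lorentzGroup} {Λₗ : lorentzGroup}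
    (hΛ : Tendsto (fun n ↦ ((Λ n : E4 ≃L[ℝ] E4) : E4 →L[ℝ] E4)) atTop
      (𝓝 ((Λₗ : E4 ≃L[ℝ] E4) : E4 →L[ℝ] E4))) :
    Tendsto (fun n ↦ (((Λ n : E4 ≃L[ℝ] E4) (E4.basisVector 0)) 0)⁻¹ •
      E4.spatial ((Λ n : E4 ≃L[ℝ] E4) (E4.basisVector 0))) atTop
      (𝓝 ((((Λₗ : E4 ≃L[ℝ] E4) (E4.basisVector 0)) 0)⁻¹ •
        E4.spatial ((Λₗ : E4 ≃L[ℝ] E4) (E4.basisVector 0)))) := by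
  have hv : Continuous fun L : E4 →L[ℝ] E4 ↦ L (E4.basisVector 0) :=
    continuous_id.clm_apply continuous_const
  have h1 : Tendsto (fun n ↦ (Λ n : E4 ≃L[ℝ] E4) (E4.basisVector 0)) atTop
      (𝓝 ((Λₗ : E4 ≃L[ℝ] E4) (E4.basisVector 0))) := by
    have h := (hv.tendsto _).comp hΛ
    simpa only [Function.comp_def, ContinuousLinearEquiv.coe_coe] using h
  have h2 : Tendsto (fun n ↦ (Λ n : E4 ≃L[ℝ] E4) (E4.basisVector 0) 0) atTop
      (𝓝 ((Λₗ : E4 ≃L[ℝ] E4) (E4.basisVector 0) 0)) :=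
    ((EuclideanSpace.proj (0 : Fin 4)).continuous.tendsto _).comp h1
  have h0 : (Λₗ : E4 ≃L[ℝ] E4) (E4.basisVector 0) 0 ≠ 0 :=
    abs_pos.1 (one_pos.trans_le (one_le_abs_lorentz_apply_zero Λₗ))
  exact (h2.inv₀ h0).smul ((E4.spatial.continuous.tendsto _).comp h1)

/-- **The velocity separation is closed**: if the boosts of holes `i`, `j` converge and their
coordinate velocities stay at distance `≥ v₀`, so do the limit velocities. [folklore] -/
private theorem sep_of_tendsto {v₀ : ℝ} {Λ Λ' : ℕ → lorentzGroup} {Λₗ Λₗ' : lorentzGroup}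
    (hΛ : Tendsto (fun n ↦ ((Λ n : E4 ≃L[ℝ] E4) : E4 →L[ℝ] E4)) atTop
      (𝓝 ((Λₗ : E4 ≃L[ℝ] E4) : E4 →L[ℝ] E4)))
    (hΛ' : Tendsto (fun n ↦ ((Λ' n : E4 ≃L[ℝ] E4) : E4 →L[ℝ] E4)) atTop
      (𝓝 ((Λₗ' : E4 ≃L[ℝ] E4) : E4 →L[ℝ] E4)))
    (h : ∀ n, v₀ ≤ ‖(((Λ n : E4 ≃L[ℝ] E4) (E4.basisVector 0)) 0)⁻¹ •
      E4.spatial ((Λ n : E4 ≃L[ℝ] E4) (E4.basisVector 0)) -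
      (((Λ' n : E4 ≃L[ℝ] E4) (E4.basisVector 0)) 0)⁻¹ •
      E4.spatial ((Λ' n : E4 ≃L[ℝ] E4) (E4.basisVector 0))‖) :
    v₀ ≤ ‖(((Λₗ : E4 ≃L[ℝ] E4) (E4.basisVector 0)) 0)⁻¹ •
      E4.spatial ((Λₗ : E4 ≃L[ℝ] E4) (E4.basisVector 0)) -
      (((Λₗ' : E4 ≃L[ℝ] E4) (E4.basisVector 0)) 0)⁻¹ •
      E4.spatial ((Λₗ' : E4 ≃L[ℝ] E4) (E4.basisVector 0))‖ :=
  ge_of_tendsto ((tendsto_velocity hΛ).sub (tendsto_velocity hΛ')).norm (Eventually.of_forall h)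

/-- **The scalar margins are closed**: along convergent masses, spins and radii the conditions
`m₀ ≤ M ≤ m₀⁻¹`, `|a| ≤ χ M`, `r₋(M,a) + μ ≤ r ≤ r₊(M,a) − μ` pass to the limit
(`r± = M ± √(M² − a²)` are continuous). [folklore] -/
private theorem margin_of_tendsto {m₀ χ μ Mₗ aₗ rₗ : ℝ} {M a r : ℕ → ℝ}
    (hM : Tendsto M atTop (𝓝 Mₗ)) (ha : Tendsto a atTop (𝓝 aₗ)) (hr : Tendsto r atTop (𝓝 rₗ))
    (h : ∀ n, m₀ ≤ M n ∧ M n ≤ m₀⁻¹ ∧ |a n| ≤ χ * M n ∧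
      Kerr.rMinus (M n) (a n) + μ ≤ r n ∧ r n + μ ≤ Kerr.rPlus (M n) (a n)) :
    m₀ ≤ Mₗ ∧ Mₗ ≤ m₀⁻¹ ∧ |aₗ| ≤ χ * Mₗ ∧ Kerr.rMinus Mₗ aₗ + μ ≤ rₗ ∧
      rₗ + μ ≤ Kerr.rPlus Mₗ aₗ := by
  unfold Kerr.rMinus Kerr.rPlus at h ⊢
  have hs : Tendsto (fun n ↦ √(M n ^ 2 - a n ^ 2)) atTop (𝓝 √(Mₗ ^ 2 - aₗ ^ 2)) :=
    ((hM.pow 2).sub (ha.pow 2)).sqrt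
  exact ⟨ge_of_tendsto hM (Eventually.of_forall fun n ↦ (h n).1),
    le_of_tendsto hM (Eventually.of_forall fun n ↦ (h n).2.1),
    le_of_tendsto_of_tendsto ha.abs (hM.const_mul χ) (Eventually.of_forall fun n ↦ (h n).2.2.1),
    le_of_tendsto_of_tendsto ((hM.sub hs).add_const μ) hr
      (Eventually.of_forall fun n ↦ (h n).2.2.2.1),
    le_of_tendsto_of_tendsto (hr.add_const μ) (hM.add hs)
      (Eventually.of_forall fun n ↦ (h n).2.2.2.2)⟩

/-- stub T1 — **COMPACTNESS OF THE MARGIN FAMILY** (registered stub of crux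
stmt-FinalStateConjecture-17646, line `registered`).  A sequence `s n = ⟨Nₙ; Mₙ, aₙ, r₀ₙ; moₙ⟩`
of multi-Kerr configurations in one margin family `(N₀, m₀, χ, μ, v₀, L₀)` — hole count
`≤ N₀`, masses in `[m₀, m₀⁻¹]`, spins `|a| ≤ χ M`, inner radii `μ`-inside `[r₋, r₊]`, boosts of
pointwise bound `L₀`, coordinate velocities pairwise `v₀`-separated — has a subsequence of
constant hole count `N ≤ N₀` along which masses, spins and radii converge, the boosts converge
in operator norm together with their inverses, and the limit configuration (centres set to `0`)
satisfies the same margins.  Proof: pigeonhole on the hole count, Bolzano–Weierstrass in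
`(Fin N → ℝ)³ × (Fin N → (E4 →L E4))` (the boosts range in the compact set of `η`-isometries of
bounded Lorentz factor), continuity of `Ring.inverse` at units, and closedness of the margins.
[folklore] -/
theorem stub_marginCompactness : ∀ (N₀ : ℕ) (m₀ χ μ v₀ L₀ : ℝ) (s : ℕ → (Σ N : ℕ, (Fin N → ℝ) × (Fin N → ℝ) × (Fin N → ℝ) × (Fin N → ↥lorentzGroup × E4))), (∀ n, (s n).1 ≤ N₀ ∧ (∀ i, m₀ ≤ (s n).2.1 i ∧ (s n).2.1 i ≤ m₀⁻¹ ∧ |(s n).2.2.1 i| ≤ χ * (s n).2.1 i ∧ Kerr.rMinus ((s n).2.1 i) ((s n).2.2.1 i) + μ ≤ (s n).2.2.2.1 i ∧ (s n).2.2.2.1 i + μ ≤ Kerr.rPlus ((s n).2.1 i) ((s n).2.2.1 i) ∧ ∀ v : E4, ‖(((s n).2.2.2.2 i).1 : E4 ≃L[ℝ] E4) v‖ ≤ L₀ * ‖v‖) ∧ (∀ i j, i ≠ j → v₀ ≤ ‖((((s n).2.2.2.2 i).1 : E4 ≃L[ℝ] E4) (E4.basisVector 0) 0)⁻¹ • E4.spatial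 ((((s n).2.2.2.2 i).1 : E4 ≃L[ℝ] E4) (E4.basisVector 0)) - ((((s n).2.2.2.2 j).1 : E4 ≃L[ℝ] E4) (E4.basisVector 0) 0)⁻¹ • E4.spatial ((((s n).2.2.2.2 j).1 : E4 ≃L[ℝ] E4) (E4.basisVector 0))‖)) → ∃ (N : ℕ) (M a r₀ : ℕ → Fin N → ℝ) (mo : ℕ → Fin N → ↥lorentzGroup × E4) (φ : ℕ → ℕ) (Mₗ aₗ rₗ : Fin N → ℝ) (moₗ : Fin N → ↥lorentzGroup × E4), StrictMono φ ∧ (∀ n, s (φ n) = ⟨N, M n, a n, r₀ n, mo n⟩) ∧ (∀ i, Tendsto (fun n ↦ M n i) atTop (𝓝 (Mₗ i))) ∧ (∀ i, Tendsto (fun n ↦ a n i) atTop (𝓝 (aₗ i))) ∧ (∀ i, Tendsto (fun n ↦ r₀ n i) atTop (𝓝 (rₗ i))) ∧ (∀ i, Tendsto (fun n ↦ (((mo n i).1 : E4 ≃L[ℝ] E4) : E4 →L[ℝ] E4)) atTop (𝓝 (((moₗ i).1 : E4 ≃L[ℝ] E4) : E4 →L[ℝ] E4))) ∧ (∀ i,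 Tendsto (fun n ↦ (((mo n i).1 : E4 ≃L[ℝ] E4).symm : E4 →L[ℝ] E4)) atTop (𝓝 (((moₗ i).1 : E4 ≃L[ℝ] E4).symm : E4 →L[ℝ] E4))) ∧ (N ≤ N₀ ∧ (∀ i, m₀ ≤ Mₗ i ∧ Mₗ i ≤ m₀⁻¹ ∧ |aₗ i| ≤ χ * Mₗ i ∧ Kerr.rMinus (Mₗ i) (aₗ i) + μ ≤ rₗ i ∧ rₗ i + μ ≤ Kerr.rPlus (Mₗ i) (aₗ i) ∧ ∀ v : E4, ‖((moₗ i).1 : E4 ≃L[ℝ] E4) v‖ ≤ L₀ * ‖v‖) ∧ (∀ i j, i ≠ j → v₀ ≤ ‖(((moₗ i).1 : E4 ≃L[ℝ] E4) (E4.basisVector 0) 0)⁻¹ • E4.spatial (((moₗ i).1 : E4 ≃L[ℝ] E4) (E4.basisVector 0)) - (((moₗ j).1 : E4 ≃L[ℝ] E4) (E4.basisVector 0) 0)⁻¹ • E4.spatial (((moₗ j).1 : E4 ≃L[ℝ] E4) (E4.basisVector 0))‖)) := by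
  intro N₀ m₀ χ μ v₀ L₀ s h
  -- (1) pigeonhole: constant hole count `N` along a subsequence `φ₁`
  obtain ⟨N, hNN₀, φ₁, hφ₁, hφ₁N⟩ := exists_const_subseq (fun n ↦ (s n).1) N₀ fun n ↦ (h n).1
  -- (2) straighten the fibre over `N`
  choose q hq using fun n ↦ sigma_fiber_eq (s (φ₁ n)) (hφ₁N n)
  have hq' : ∀ n, (∀ i, m₀ ≤ (q n).1 i ∧ (q n).1 i ≤ m₀⁻¹ ∧ |(q n).2.1 i| ≤ χ * (q n).1 i ∧
      Kerr.rMinus ((q n).1 i) ((q n).2.1 i) + μ ≤ (q n).2.2.1 i ∧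
      (q n).2.2.1 i + μ ≤ Kerr.rPlus ((q n).1 i) ((q n).2.1 i) ∧
      ∀ v : E4, ‖(((q n).2.2.2 i).1 : E4 ≃L[ℝ] E4) v‖ ≤ L₀ * ‖v‖) ∧
      (∀ i j, i ≠ j → v₀ ≤ ‖((((q n).2.2.2 i).1 : E4 ≃L[ℝ] E4) (E4.basisVector 0) 0)⁻¹ •
        E4.spatial ((((q n).2.2.2 i).1 : E4 ≃L[ℝ] E4) (E4.basisVector 0)) -
        ((((q n).2.2.2 j).1 : E4 ≃L[ℝ] E4) (E4.basisVector 0) 0)⁻¹ •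
        E4.spatial ((((q n).2.2.2 j).1 : E4 ≃L[ℝ] E4) (E4.basisVector 0))‖) := by
    intro n
    have h1 := (h (φ₁ n)).2
    rw [hq n] at h1
    exact h1
  -- (3) Bolzano–Weierstrass along a further subsequence `φ₂`
  have hb : ∀ n i, |(q n).1 i| ≤ 2 * (|m₀| + |m₀⁻¹|) + |χ| * (|m₀| + |m₀⁻¹|) + |μ| ∧
      |(q n).2.1 i| ≤ 2 * (|m₀| + |m₀⁻¹|) + |χ| * (|m₀| + |m₀⁻¹|) + |μ| ∧
      |(q n).2.2.1 i| ≤ 2 * (|m₀| + |m₀⁻¹|) + |χ| * (|m₀| + |m₀⁻¹|) + |μ| := fun n i ↦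
    abs_coords_le ((hq' n).1 i).1 ((hq' n).1 i).2.1 ((hq' n).1 i).2.2.1 ((hq' n).1 i).2.2.2.1
      ((hq' n).1 i).2.2.2.2.1
  obtain ⟨φ₂, Mₗ, aₗ, rₗ, Λₗ, hφ₂, hM, ha, hr, hΛ⟩ := exists_tendsto_subseq
    (2 * (|m₀| + |m₀⁻¹|) + |χ| * (|m₀| + |m₀⁻¹|) + |μ|) L₀ (fun n ↦ (q n).1) (fun n ↦ (q n).2.1)
    (fun n ↦ (q n).2.2.1) (fun n ↦ (q n).2.2.2) hb fun n i v ↦ ((hq' n).1 i).2.2.2.2.2 v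
  -- (4) assemble: centres of the limit configuration are set to `0`
  refine ⟨N, fun n ↦ (q (φ₂ n)).1, fun n ↦ (q (φ₂ n)).2.1, fun n ↦ (q (φ₂ n)).2.2.1,
    fun n ↦ (q (φ₂ n)).2.2.2, φ₁ ∘ φ₂, Mₗ, aₗ, rₗ, fun i ↦ (Λₗ i, 0), hφ₁.comp hφ₂,
    fun n ↦ hq (φ₂ n), hM, ha, hr, hΛ, fun i ↦ tendsto_lorentz_symm (hΛ i), hNN₀,
    fun i ↦ ?_, fun i j hij ↦ sep_of_tendsto (hΛ i) (hΛ j) fun n ↦ (hq' (φ₂ n)).2 i j hij⟩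
  -- (5) the margins are closed conditions
  obtain ⟨h1, h2, h3, h4, h5⟩ := margin_of_tendsto (hM i) (ha i) (hr i) fun n ↦
    ⟨((hq' (φ₂ n)).1 i).1, ((hq' (φ₂ n)).1 i).2.1, ((hq' (φ₂ n)).1 i).2.2.1,
      ((hq' (φ₂ n)).1 i).2.2.2.1, ((hq' (φ₂ n)).1 i).2.2.2.2.1⟩
  exact ⟨h1, h2, h3, h4, h5, fun v ↦
    norm_apply_le_of_tendsto (hΛ i) (fun n v ↦ ((hq' (φ₂ n)).1 i).2.2.2.2.2 v) v⟩

end Summit.FinalStateConjecture.FinalStateConjecture.Theorems.KerrnessPropagates.KerrBasinCapture
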